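import Literature.NumberTheory.EllipticCurves.TowerLocalH1LiftExactProofs
import Literature.NumberTheory.EllipticCurves.TowerSaturatedCartesianScalarProofs
import HarnessLib

/-!
# Saturated conditions of the `H¹`-tower of an exact `p`-power tower of finite discrete Galois modules are
# cartesian along `×p^d` — turnkey form (theorems only)

`Proofs` file (no definition, no named fact, no instance, no `sorry`).  Companion of
`TowerSaturatedCartesianProofs` (abstract core `Tower.comap_levelCondition_eq_of_liftable`, x10b-p2 LEAD g5) and
`TowerLocalH1LiftExactProofs` (its cohomological inputs (L)/(E)/(M)/(T) for towers of `H¹`'s presented by a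
two-index family of equivariant maps, x10b-p1-w7).  Here the two are ASSEMBLED for the `p`-power case:

* `Tower.map_natCastIntertwining_eq_nsmul` — `H¹(n•) = n•` on `H¹(F, W)` (the tree's functorial scalar action at
  `R = ℤ`, `galoisCohomology.scalarMapH1_intCast`).
* **`Tower.comap_map_levelCondition_eq_of_exact_nsmul`** — for a tower of finite discrete `Γ_F`-modules
  presented by `f a b : W a → W b` (reductions for `b ≤ a`, the injective `Quot`-morphisms for `a ≤ b`) with
  `f a a = id`, composable reductions, the one-step mixed square, exact rows
  `0 → W ℓ → W (ℓ+n) → W n → 0`, finite `H¹(F, W j)`, and the two scalar identities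
  `f ℓ (ℓ+n) ∘ f (ℓ+n) ℓ = p^n •` on `W (ℓ+n)` and `p^j • W j = 0` (the `p`-adic tower `W j = T/p^j T` of a
  `ℤ_p`-free `T` with `f ℓ (ℓ+n) = ×p^n`), and ANY cores `C j`:
  `(levelCondition red p C (i+d)).comap H¹(f i (i+d)) = levelCondition red p C i` — Howard's H.3 («`F` is
  cartesian on `Quot(T)`», Def. 1.1.2–1.1.3, arXiv:1202.6340 p. 5 L88–99, p. 16 L1–3; Mazur–Rubin Lemma 3.7.1)
  for the SATURATED level conditions along the `Quot(T)`-morphisms `×p^d : T/p^i ↪ T/p^{i+d}`, with no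
  hypothesis left on the cohomology side.

* **`Tower.comap_map_levelCondition_eq_of_exact_smul`** — the `π`-ADIC form: `R`-linear levels
  (`IsScalarLinear R`, `R`-linear `f a b`), a scalar `π` with `(p : R) ∈ (π)`, `f ℓ (ℓ+n) ∘ f (ℓ+n) ℓ = π^n •`,
  `π^j • W j = 0`, cores stable under `H¹(r•)`: the same identity along `×π^d : T/π^i ↪ T/π^{i+d}` — the
  assembly over x10b-p1-w6's `Tower.comap_levelCondition_eq_of_liftable_smul` (the `H¹`'s made `R`-modules by
  the tree's functorial `galoisCohomology.moduleH1`, installed locally inside the proof only).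

Cell `pub/bsd-print-x9`, shared μ-item of rows 9/10, skeleton v9 STUB 1b (H.3); seat `bsd-line-x10b-p1-w7` g0.
No summit statement is proved; BSD is not proved by any of this.

References: B. Howard, Compositio Math. 140 (2004), Def. 1.1.2–1.1.3, H.3, §1.6 (arXiv:1202.6340 p. 5, p. 12,
p. 16); B. Mazur, K. Rubin (2004), Lemma 3.7.1; J.-P. Serre, *Galois Cohomology* (1997), I §2.2.
-/

noncomputable section

open CategoryTheory
open scoped ContRepresentation

universe u

namespace Literature.NumberTheory.EllipticCurves

namespace Tower

open Literature.NumberTheory.GaloisRepresentations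

variable {F : Type u} [Field F]
variable {W : ℕ → Type u} [∀ j, AddCommGroup (W j)] [∀ j, TopologicalSpace (W j)]
  [∀ j, DiscreteTopology (W j)]
variable (ρ : ∀ j, DiscreteGaloisModule F (W j))
variable (f : ∀ a b, (ρ a).toContRepresentation →ⁱL (ρ b).toContRepresentation)

/-- **`H¹(n•) = n•`**: the map induced on `H¹(F, M)` by the equivariant endomorphism `m ↦ (n : ℤ) • m` is
multiplication by `n` (tree `galoisCohomology.scalarMapH1_intCast` at `R = ℤ`).
[cite: SerreGaloisCohomology1997, Ch. I §2.2 (functoriality of Hⁿ(G, A) in A)] -/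
theorem map_natCastIntertwining_eq_nsmul {M : Type u} [AddCommGroup M] [TopologicalSpace M]
    [DiscreteTopology M] (τ : DiscreteGaloisModule F M) (n : ℕ) (c : galoisCohomology τ 1) :
    galoisCohomology.map
        (DiscreteGaloisModule.scalarIntertwining τ (DiscreteGaloisModule.isScalarLinear_int τ) (n : ℤ)) 1 c =
      n • c := by
  have h := galoisCohomology.scalarMapH1_intCast τ (DiscreteGaloisModule.isScalarLinear_int τ) (n : ℤ) c
  rw [Int.cast_id, natCast_zsmul] at h
  exact h

/-- **Saturated level conditions are cartesian along `×p^d` — turnkey form for `p`-power towers of `H¹`'s.**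
For a tower of finite discrete `Γ_F`-modules presented by a two-index family `f a b` (identities `hid`, `hcomp`,
`hsq`; exact rows `hinj`, `hsurj`, `hex`; finite `H¹`'s) in which `f ℓ (ℓ+n) ∘ f (ℓ+n) ℓ` is multiplication by
`p^n` and `p^j` kills `W j`, and for any cores `C j ≤ H¹(F, W j)`:
`(levelCondition red p C (i+d)).comap H¹(f i (i+d)) = levelCondition red p C i`, `red j = H¹(f (j+1) j)`.
This is `Tower.comap_levelCondition_eq_of_liftable` with ALL FOUR hypotheses (M), (T), (L), (E) discharged by
`TowerLocalH1LiftExactProofs`. [cite: Howard2004HeegnerKolyvagin, H.3 and Def. 1.1.2–1.1.3 (arXiv p. 5 L88–99, p. 16 L1–3)]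
[cite: MazurRubinMemoirs2004, Lemma 3.7.1] -/
theorem comap_map_levelCondition_eq_of_exact_nsmul [∀ j, Finite (galoisCohomology (ρ j) 1)]
    (hid : ∀ a (w : W a), f a a w = w)
    (hcomp : ∀ a b c, c ≤ b → b ≤ a → ∀ w : W a, f b c (f a b w) = f a c w)
    (hsq : ∀ a b, a ≤ b → ∀ w : W (a + 1), f a b (f (a + 1) a w) = f (b + 1) b (f (a + 1) (b + 1) w))
    (hinj : ∀ ℓ n, Function.Injective (f ℓ (ℓ + n)))
    (hsurj : ∀ ℓ n, Function.Surjective (f (ℓ + n) n))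
    (hex : ∀ ℓ n (y : W (ℓ + n)), f (ℓ + n) n y = 0 ↔ ∃ x, f ℓ (ℓ + n) x = y)
    (p : ℕ) (hpow : ∀ ℓ n (w : W (ℓ + n)), f ℓ (ℓ + n) (f (ℓ + n) ℓ w) = p ^ n • w)
    (hkill : ∀ j (w : W j), p ^ j • w = 0)
    (C : ∀ j, AddSubgroup (galoisCohomology (ρ j) 1)) (i d : ℕ) :
    (levelCondition (H := fun j ↦ galoisCohomology (ρ j) 1) (fun j ↦ galoisCohomology.map (f (j + 1) j) 1)
        p C (i + d)).comap (galoisCohomology.map (f i (i + d)) 1) =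
      levelCondition (H := fun j ↦ galoisCohomology (ρ j) 1) (fun j ↦ galoisCohomology.map (f (j + 1) j) 1)
        p C i := by
  refine comap_levelCondition_eq_of_liftable (H := fun j ↦ galoisCohomology (ρ j) 1)
    (fun j ↦ galoisCohomology.map (f (j + 1) j) 1) p C i d (galoisCohomology.map (f i (i + d)) 1)
    (fun y ↦ ?_) (fun y ↦ ?_)
    (exists_mem_compatibleFamilies_apply_eq_of_map_eq ρ f hid hcomp hsq hinj hsurj hex i d)
    (fun x hx hx0 ↦ ?_)
  · -- (M)
    rw [map_redIter_eq_map_endo ρ f hid hcomp i d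
      (DiscreteGaloisModule.scalarIntertwining _ (DiscreteGaloisModule.isScalarLinear_int _) ((p ^ d : ℕ) : ℤ))
      (fun w ↦ by rw [DiscreteGaloisModule.scalarIntertwining_apply, natCast_zsmul, hpow i d w]) y]
    exact map_natCastIntertwining_eq_nsmul (ρ (i + d)) (p ^ d) y
  · -- (T)
    rw [← map_natCastIntertwining_eq_nsmul (ρ i) (p ^ i) y]
    exact galoisCohomology.map_eq_zero_of_apply_eq_zero _
      (fun w ↦ by rw [DiscreteGaloisModule.scalarIntertwining_apply, natCast_zsmul, hkill i w]) y
  · -- (E)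
    obtain ⟨h, hh, hhx⟩ := exists_forall_map_endo_eq_of_apply_eq_zero ρ f hid hcomp hsq hinj hsurj hex (i + d)
      (fun j ↦ DiscreteGaloisModule.scalarIntertwining _ (DiscreteGaloisModule.isScalarLinear_int _)
        ((p ^ (i + d) : ℕ) : ℤ))
      (fun ℓ w ↦ by rw [DiscreteGaloisModule.scalarIntertwining_apply, natCast_zsmul, hpow ℓ (i + d) w])
      (fun j hj w ↦ by
        obtain ⟨e, he⟩ := Nat.exists_eq_add_of_le hj.le
        rw [DiscreteGaloisModule.scalarIntertwining_apply, natCast_zsmul, he, pow_add, mul_comm, mul_smul,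
          hkill j w, smul_zero])
      hx hx0
    refine ⟨h, hh, funext fun j ↦ ?_⟩
    rw [Pi.smul_apply, ← hhx j]
    exact map_natCastIntertwining_eq_nsmul (ρ j) (p ^ (i + d)) (h j)

/-- **Saturated level conditions are cartesian along `×π^d` — turnkey form for `π`-power towers of `H¹`'s**
(the `π`-adic refinement `… → T/π^{i+1} → T/π^i → …` of Howard's `Quot(T)`, `𝔪 = (π)`, `p ∈ (π)`): for
`R`-linear finite discrete levels presented by an `R`-linear two-index family `f a b` (identities `hid`, `hcomp`,
`hsq`; exact rows; finite `H¹`'s) with `f ℓ (ℓ+n) ∘ f (ℓ+n) ℓ = π^n •` and `π^j • W j = 0`, and cores stable under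
the functorial scalar action `H¹(r•)`:
`(levelCondition red p C (i+d)).comap H¹(f i (i+d)) = levelCondition red p C i`.
This is x10b-p1-w6's `Tower.comap_levelCondition_eq_of_liftable_smul` with (M), (T), (L), (E) discharged by
`TowerLocalH1LiftExactProofs` (the `R`-module structures on the `H¹`'s are the tree's `galoisCohomology.moduleH1`,
installed inside the proof). [cite: Howard2004HeegnerKolyvagin, H.3 and Def. 1.1.2–1.1.3 (arXiv p. 5 L88–99, p. 16 L1–3)]
[cite: MazurRubinMemoirs2004, Lemma 3.7.1] -/
theorem comap_map_levelCondition_eq_of_exact_smul {R : Type*} [CommRing R] [∀ j, Module R (W j)]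
    [∀ j, Finite (galoisCohomology (ρ j) 1)] (hρ : ∀ j, (ρ j).IsScalarLinear R)
    (hid : ∀ a (w : W a), f a a w = w)
    (hcomp : ∀ a b c, c ≤ b → b ≤ a → ∀ w : W a, f b c (f a b w) = f a c w)
    (hsq : ∀ a b, a ≤ b → ∀ w : W (a + 1), f a b (f (a + 1) a w) = f (b + 1) b (f (a + 1) (b + 1) w))
    (hinj : ∀ ℓ n, Function.Injective (f ℓ (ℓ + n)))
    (hsurj : ∀ ℓ n, Function.Surjective (f (ℓ + n) n))
    (hex : ∀ ℓ n (y : W (ℓ + n)), f (ℓ + n) n y = 0 ↔ ∃ x, f ℓ (ℓ + n) x = y)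
    (hlin : ∀ a b (r : R) (w : W a), f a b (r • w) = r • f a b w)
    (p : ℕ) (π : R) (hp : ((p : ℕ) : R) ∈ Ideal.span {π})
    (hpow : ∀ ℓ n (w : W (ℓ + n)), f ℓ (ℓ + n) (f (ℓ + n) ℓ w) = π ^ n • w)
    (hkill : ∀ j (w : W j), π ^ j • w = 0)
    (C : ∀ j, AddSubgroup (galoisCohomology (ρ j) 1))
    (hC : ∀ j (r : R) (y : galoisCohomology (ρ j) 1), y ∈ C j →
      galoisCohomology.scalarMapH1 (ρ j) (hρ j) r y ∈ C j)
    (i d : ℕ) :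
    (levelCondition (H := fun j ↦ galoisCohomology (ρ j) 1) (fun j ↦ galoisCohomology.map (f (j + 1) j) 1)
        p C (i + d)).comap (galoisCohomology.map (f i (i + d)) 1) =
      levelCondition (H := fun j ↦ galoisCohomology (ρ j) 1) (fun j ↦ galoisCohomology.map (f (j + 1) j) 1)
        p C i := by
  letI : ∀ j, Module R (galoisCohomology (ρ j) 1) := fun j ↦ galoisCohomology.moduleH1 (ρ j) (hρ j)
  refine comap_levelCondition_eq_of_liftable_smul (H := fun j ↦ galoisCohomology (ρ j) 1)
    (fun j ↦ galoisCohomology.map (f (j + 1) j) 1)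
    (fun j r x ↦ galoisCohomology.map_scalarMapH1 (hρ _) (hρ _) (f (j + 1) j) (hlin _ _) r x) p C
    (fun j r y hy ↦ hC j r y hy) i d (galoisCohomology.map (f i (i + d)) 1) π hp
    (fun y ↦ map_redIter_eq_scalarMapH1 ρ f hρ hid hcomp i d (π ^ d) (fun w ↦ (hpow i d w).symm) y)
    (fun y ↦ scalarMapH1_eq_zero_of_forall (ρ i) (hρ i) (π ^ i) (hkill i) y)
    (exists_mem_compatibleFamilies_apply_eq_of_map_eq ρ f hid hcomp hsq hinj hsurj hex i d)
    (fun x hx hx0 ↦ ?_)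
  obtain ⟨h, hh, hhx⟩ := exists_forall_scalarMapH1_eq_of_apply_eq_zero ρ f hρ hid hcomp hsq hinj hsurj hex
    (i + d) (π ^ (i + d)) (fun ℓ w ↦ (hpow ℓ (i + d) w).symm)
    (fun j hj w ↦ by
      obtain ⟨e, he⟩ := Nat.exists_eq_add_of_le hj.le
      rw [he, pow_add, mul_comm, mul_smul, hkill j w, smul_zero]) hx hx0
  exact ⟨h, hh, funext fun j ↦ (hhx j).symm⟩

end Tower

end Literature.NumberTheory.EllipticCurves

end
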